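import Mathlib
import HarnessLib
import HarnessLib.Audit
import Summits.AtomisticToContinuum.Statement
import Literature.MathematicalPhysics.QuantumManyBody.PeriodicBoseGas

/-!
Route: BECScaleChaining

CLOSED (retired) 2026-08-15T13:40:20Z by operator:999:1257524 — reason: not-a-thesis: assembly does not conclude the sub-problem Statement — note: D-0027 §2.1 audit (human 2026-08-15: routes that do not decide the summit are removed): the assembly concludes `Literature.MathematicalPhysics.QuantumManyBody.BoseGas.BoseEinsteinCondensation`, not the sub-problem statement; a NEW conforming route may be opened from the same idea (generated `closes . The file is kept as the record of this route; refuted decls are indexed as negative knowledge (`ledger negatives`).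

# Route BECScaleChaining — coherent amplitude of dyadic block condensates telescopes across scales —
BEC needs only a SUMMABLE per-level norm defect, geometric by Josephson scaling E_C/E_J ∝ ℓ⁻⁴

X = DyadicCoherenceDefect ∧ BaseCoherentMass ("it suffices to show"; realises card
coherence-angle-scale-chaining, with the card's
Gram-ANGLE triangle inequality replaced by the NORM DEFECT of Gram vectors, which adds decoherence
in quadrature). Tile the Dirichlet box
Λ_L, L = (N/ρ)^{1/3}, by open dyadic cubes C of side s_m = L/2^m (level m) with normalised modes φ_C
= s_m^{-3/2} 1_C, and put
A_m(Ψ) := 8^{-m/2} Σ_{C ∈ level m} √⟨φ_C, γ_Ψ φ_C⟩ (the COHERENT AMPLITUDE at level m; A_0 =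
√(constant-mode occupation), A_m ↑ in m).
DyadicCoherenceDefect (rank 2): for δ-near-minimisers, A_m ≤ A_{m−1} + β_j √N at every level whose
cube side lies in [ℓ_d 2^j, ℓ_d 2^{j+1}),
with ONE budget β = β(v,ρ) ≥ 0, Σ_j β_j ≤ 1/4, uniform in N. BaseCoherentMass (rank 3): at some base
scale ℓ_b ≥ ℓ_d (ℓ_b ~ healing
length), A_K ≥ √N/2 for the level K with L/2^K ∈ [ℓ_b, 2ℓ_b). Telescoping gives √N ≤ 2A_K ≤ 2A_0 +
√N/2, i.e. ⟨φ₀, γ_Ψ φ₀⟩ ≥ N/16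
(X_B1, stmt-AtomisticToContinuum-0686 with c = 1/16), hence BoseEinsteinCondensation by the proved
theorem bec_of_zeroMode.
Lean: `DyadicCoherenceDefect ∧ BaseCoherentMass`

## Assembly
Pure logic plus one proved theorem. Fix v; DyadicCoherenceDefect gives ℓ_d, ρ₀′, then
BaseCoherentMass (fed this ℓ_d) gives ρ₀″; for
ρ < min: β and ℓ_b ≥ ℓ_d; for large N: K with L/2^K ∈ [ℓ_b, 2ℓ_b), δ := min(δ′, δ″); for a
δ-near-minimiser every level 1 ≤ m ≤ K has cube
side ≥ ℓ_b ≥ ℓ_d, so a unique bracket index j(m), injective in m (sides differ by powers of 2);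
summing the per-level inequalities,
A_K ≤ A_0 + (Σ_m β_{j(m)})√N ≤ A_0 + √N/4, and √N ≤ 2A_K gives √N/2 ≤ 2A_0 = 2√(occupation of the
level-0 mode); the level-0 cube is
{x | x_k ∈ (0, L)} = box L with normalisation (√(L³))⁻¹ (checked by `example` in Sketch.lean), so
X_B1 holds with c = 1/16 and this δ, and
`AtomisticToContinuum.BECInfraredBound.bec_of_zeroMode` (Theorems/BECInfraredBoundAssembly.lean,
proved) yields the conjunct.

Rationale: WHY THIS LINE. For ANY state the block Gram vectors u_C(Y) = √N ∫ conj(φ_C) Ψ(·,Y) satisfy u_P =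
8^{-1/2} Σ_{C⊂P} u_C (φ_P = 8^{-1/2} Σ φ_C a.e.), so
A_m − A_{m−1} = 8^{-m/2} Σ_P (Σ_C ‖u_C‖ − ‖Σ_C u_C‖) ≥ 0 is a sum of LOCAL norm defects: it vanishes
identically on every pure condensate
N|φ⟩⟨φ| whatever the profile φ (so the free gas v = 0 and the Dirichlet wall layer cost nothing), it
is quadratic in the sibling
decoherence angles (the audit's "phases add in quadrature" made rigorous for arbitrary states), it
is ℓ¹ over positions (averaged outputs of
localisation engines suffice) and it TELESCOPES, so the thermodynamic limit costs a convergent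
series instead of a uniform-in-L estimate
(card coherence-angle-scale-chaining; one-step versions: Junge2026 = arXiv:2603.20776 Thm 3 / Cor 6,
Fournais2020 Thm 1.2, LSSY2005 Thm 5.1).
The per-level target is dictated by two-block Josephson physics (Leggett2001 §VI): (A_m −
A_{m−1})/√N ≍ √(ρa³)(ξ/ℓ_m)² above the healing
length ξ and ≍ ρa²ℓ_m below it — geometric on both sides, total O(√(ρa³)) against a required 1/4.
Imported: elementary Hilbert-space
geometry of PSD Gram matrices (any state, no positivity/RP), multiscale bookkeeping in the spirit of
block-spin LRO (BalabanOcarroll1999,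
BFKT2017) but with the induction carried by a functional of the TRUE γ rather than an effective
action; the base scale uses the kinetic-gap
method exactly where it is a theorem (LSSY2005 Lemma 4.1/Thm 5.1, LiebYngvason1998 cell bound — all
proved in the tree). No prior route
decomposes BY SCALE inside the fixed thermodynamic box (BECInfraredBound: per-mode IR bound;
BECPeriodicReduction: torus; BECRenormGroup:
functional-integral RG; BECParticleInduction: induction in N); negatives index empty.

RANKED CRUXES. #2 DyadicCoherenceDefect (crux) — SUMMABLE DYADIC COHERENCE DEFECT (card K1,
quadrature form). For every repulsive finite-range v there are ℓ_d(v) > 0 and ρ₀ > 0 such that for 0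
< ρ < ρ₀ there is a budget β : ℕ → [0,∞), Σ_j β_j ≤ 1/4, with: for all large N there is δ > 0 such
that every δ-near-minimiser Ψ of the Dirichlet energy in the box of side L = (N/ρ)^{1/3} satisfies,
for every level m ≥ 1 whose cube side L/2^m lies in [ℓ_d 2^j, ℓ_d 2^{j+1}): A_m ≤ A_{m−1} + β_j √N,
where A_m = 8^{-m/2} Σ_{C level m} √(occupation of s^{-3/2}1_C). Equivalently: the norm defect
Σ_P(Σ_C‖u_C‖ − ‖Σ_C u_C‖) summed over parents of side 2^{1+j}ℓ_d is ≤ 8^{m/2} β_j √N, uniformly in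
N. [difficulty: open-problem] (why it might fail: at the top levels (cube side L/2, L/4) β_j → 0
demands inter-octant phase coherence of the Dirichlet ground state uniformly in N — the
thermodynamic difficulty itself; an energetic per-level engine pays ℓ²×(local excess) as in
Junge2026 Rem 7, and no non-energetic engine is in print.) [arXiv:2603.20776, Fournais2020,
Leggett2001, LSSY2005, BFKT2017]
#3 BaseCoherentMass (crux) — COHERENT MASS AT A HEALING-TYPE BASE SCALE (card P/WindowBase moved
down to ℓ_b ~ ξ√ε). For every repulsive finite-range v and every ℓ_d > 0 there is ρ₀ > 0 such that
for 0 < ρ < ρ₀ there is ℓ_b ≥ ℓ_d with: for all large N there are a level K with L/2^K ∈ [ℓ_b, 2ℓ_b)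
and δ > 0 such that every δ-near-minimiser has A_K ≥ √N/2, i.e. (8^{-K/2} Σ_B √n_B)² ≥ N/4 over the
base cubes B. Route to it: Σ_B n_B ≥ (1−ε)N by Poincaré in each cube against T ≤ C N ρ a (+ walls),
and (Σ√n_B)² ≥ (Σ n_B)³/Σ n_B² with anti-concentration Σ_B N_B² ≤ Λ N² 8^{-K} from the Lieb–Yngvason
cell lower bound versus the leading upper bound; free gas: A_K/√N → (2√2/π)³ ≈ 0.73. [difficulty: L]
(why it might fail: needs E₀ < ∞ and E₀ ≤ 4πaρN(1+o(1)) + O(N/L²) for DIRICHLET boxes incl. hard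
cores (only periodic upper bound in tree), and no-clumping Σ_B N_B² ≲ N²/8^K from cell-wise LY
bounds, which require cells ≥ a(ρa³)^{-6/17} and n_B ≳ (ℓ_b/a)^{1/6}.) [LSSY2005, LiebYngvason1998,
Fournais2020, arXiv:2510.20493]
#4 WindowLocalCondensation (crux) — LOCAL CONDENSATION OF THE THERMODYNAMIC GROUND STATE ON ALL
DYADIC SCALES UP TO THE FOURNAIS WINDOW (card engine (iii); the provable half of rank 2, not in the
assembly chain). For every repulsive finite-range v (a = scattering length) and every η ∈ (0, 1/4)
there are γ > 2η, C ≥ 0 and ρ₀ > 0 such that for 0 < ρ < ρ₀, all large N, some δ > 0 and every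
δ-near-minimiser Ψ of the Dirichlet box of side L = (N/ρ)^{1/3}: for every level m with cube side s
= L/2^m ≤ (ρa)^{-1/2}(ρa³)^{-η}, Σ_{C level m} ⟨φ_C, γ_Ψ φ_C⟩ ≥ (1 − C(ρa³)^γ max(1, ρ a s²)) N. Via
Σ_C‖u_C‖ − ‖Σu_C‖ ≤ √(8(N_P − n_P)) it yields the window part of DyadicCoherenceDefect with
Σ_{window} β ≲ (ρa³)^{γ/2−η} + (ρa³)^{γ/2} log(1/ρ). Vacuous (true) for a = 0. [difficulty: XL] (why
it might fail: Fournais2020 Thm 1.2 is for PERIODIC states with the LHY-precision bound (1.8) on a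
torus tied to its own density; localising the Dirichlet ground state into dyadic sub-cubes of
varying local density with constants uniform in (C_L, δ) and summing over cubes is not in print.)
[Fournais2020, FournaisSolovej2020, BrietzkeFournaisSolovej2020, arXiv:2603.20776, arXiv:2510.20493]
#9 CoherentAmplitudeMonotone (support) — For every N, L, every Dirichlet trial state Ψ and every
level m ≥ 1: A_{m−1} ≤ A_m (sum of norms ≥ norm of sum for the eight child Gram vectors of each
parent cube; needs the L²(Y)-structure of `occupation`: u_φ ∈ L², φ ↦ u_φ linear, occupation =
‖u_φ‖², and φ_P = 8^{-1/2} Σ φ_C a.e.). Establishes the Hilbert-space API every other item uses.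
[difficulty: provable-now] [LSSY2005, PenroseOnsager1956]

TWO-LAYER PLAN. DyadicCoherenceDefect ⇐ DefectAboveWindow (cube side ≥ (ρa)^{-1/2}(ρa³)^{-η}) →
DefectInWindow (≤ that scale; follows from
WindowLocalCondensation + CoherentAmplitude algebra) → DyadicCoherenceDefect (glue: split the budget
1/8 + 1/8). Later, if an engine
appears: DefectAboveWindow ⇐ InductiveStep (budget at level m given the levels below m) → glue by
induction on m.
BaseCoherentMass ⇐ BasePoincare (Σ_B n_B ≥ (1−ε)N at ℓ_b ≤ ξ√ε: Poincaré + Dirichlet upper bound E₀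
≤ C Nρa + C′N/L²) → BaseNoClumping
(Σ_B N_B² ≤ Λ N² 8^{-K}: LY cell bound, LSSY2005_lowerBound_neumann_holds + superadditivity) →
BaseCoherentMass (glue: Hölder (Σ√n)² ≥ (Σn)³/Σn²).

KILL CRITERIA. A proof of ¬DyadicCoherenceDefect for some admissible v at arbitrarily small ρ
(non-summable per-level defect while BaseCoherentMass holds)
closes the route `refuted:DyadicCoherenceDefect` — it would mean block phases do NOT stiffen with
scale (no superfluid phase rigidity), news
for every BEC route; the refuting witness must beat the free-gas check (defect ≡ 0) and the sub-gap
δ. ¬BaseCoherentMass would contradict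
LSSY Thm 5.1-type local condensation at the healing scale — pivot to a base at the window scale
(WindowLocalCondensation becomes rank 3).
¬WindowLocalCondensation alone does not kill the line (rank 2 may still hold with a cruder window
budget). X_B1 (stmt-0686) or PeriodicBEC +
BoundaryTransfer proved elsewhere moots the route; a proof that the Dirichlet ground state condenses
into a mode asymptotically orthogonal to
the constant one (¬X_B1 with BEC true) forces the pivot "A_0 ↦ max over level-m₀ cubes": λ_max(γ) ≥
max_C n_C ≥ A_{m₀}²/8^{m₀}, i.e. stop the cascade at a fixed macroscopic level m₀ and feed
maxOccupation directly.

NOT DECOMPOSED YET. The per-level ENGINE above the window (candidates, none filed: exact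
ground-state inequalities ⟨A*[H,A]⟩ ≥ 0 for relative number/current
operators of sibling cubes; a Josephson two-block variational sandwich ⟨δθ²⟩ ≲ √(E_C/E_J) with E_J ≍
2ρℓ, E_C ≍ 8πa/ℓ³; an induction on
levels using the stiffness certified below); the regime split at the window; constants (1/4, 1/2,
1/16 are arbitrary: any Σβ < A_K/√N
works); hard-core finiteness E₀ < ∞ and the Dirichlet upper bound; the averaged-vs-max question is
moot here (all hypotheses are sums over
cubes, δ is chosen after N so near-minimisers are the ground state up to o(1)); positive temperature
and d = 2 variants (other routes).

CHEAPEST FALSIFIER. Compute the per-level defect in Bogoliubov theory on the torus: (A_m −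
A_{m−1})/√N = 8^{-m/2} Σ_P (Σ_C‖u_C‖ − ‖Σu_C‖)/√N with
⟨φ_C, γ φ_{C′}⟩ = n₀⟨φ_C,φ₀⟩⟨φ₀,φ_{C′}⟩ + Σ_{p≠0} n_p ⟨φ_C,φ_p⟩⟨φ_p,φ_{C′}⟩, n_p = (p² + 8πρa −
ε_p)/(2ε_p): a kit job over ρa³ ∈
{10⁻⁶,…,10⁻³}, ℓ/ξ ∈ [2⁻⁴, 2⁸] must show the two-sided geometric profile peaking at ℓ ≈ ξ with Σ_m =
O(√(ρa³)) ≪ 1/4; saturation or growth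
in ℓ beyond ξ kills rank 2 at the level of its own heuristic. Done by hand here: free gas v = 0 (γ
rank one) gives defect ≡ 0 and
A_K/√N → (2√2/π)³ = 0.7298 ≥ 1/2, so neither crux is refuted by the admissible v = 0; d = 1
analogue: E_C/E_J scale-free ⇒ Σβ ~ log L
diverges, consistent with Girardeau (OneDimensionalHardCore) — the statement is dimension-sensitive
as it must be.

NUMBERS. Required: Σ_j β_j ≤ 1/4, A_K ≥ √N/2, output c = 1/16. Predicted (Bogoliubov/Josephson,
Leggett2001 §VI; ħ = 2m = 1, ξ = (8πρa)^{-1/2}):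
E_J ≍ 2ρℓ, E_C ≍ 8πa/ℓ³, ⟨δθ²⟩ ≍ ½√(E_C/E_J) = √(πa/ρ)/ℓ², per-level defect/√N ≍ 0.2–0.5·⟨δθ²⟩ ≍
√(ρa³)(ξ/ℓ)² for ℓ ≳ ξ, ≍ ρa²ℓ for
a ≲ ℓ ≲ ξ; Σ over all dyadic levels = O(√(ρa³)). In-class records the window crux leans on:
Fournais2020 Thm 1.2 (n₊/n ≤ Cρas²(ρa³)^{1/2−ε},
s = C_L(ρa³)^{-δ}(ρa)^{-1/2}, 2δ + ε < 1/2; proved in tree as Fournais2020_condensation_holds);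
Junge2026 Cor 6 (R ≥ a(ρa³)^{-1/2−η}:
n₊ ≤ CNρR²a(ρa³)^{1/2+η}, η = 1/32 at T = 0, Rem 5; κ ≤ (2+2η)/(5+3η) vs thermodynamic κ = 2/3, Rem
7); LSSY2005 Thm 2.4 (4πρa(1 − CY^{1/17}),
cells L/a > C′Y^{-6/17}; proved as LSSY2005_lowerBound_neumann_holds). Free gas: constant-mode
fraction (8/π²)³ = 0.533, A_K/√N → 0.730.
Items at open: 5 (3 cruxes, 1 support, 1 assembly).

DEFINITION REQUESTS. None required: cubes, modes and A_m are inlined over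
`Literature.MathematicalPhysics.QuantumManyBody.BoseGas.{occupation, TrialState,
energy, groundStateEnergy, sideLength, IsRepulsiveFiniteRange, scatteringLength}` with `let`
binders. Convenience definitions a prover may add
in Theorems (not items): dyadic cube / block mode / Gram vector u_φ ∈ L²(Config (N−1)) with
occupation = ‖u_φ‖² and sesquilinearity — the
off-diagonal γ(φ,ψ) also wanted by card continuum-gaussian-domination. Bib added this session:
Leggett2001, BalabanOcarroll1999.

Novelty: Searches (2026-08-15): `lit search --hybrid` "multiscale block condensate coherence dilute Bose gas
thermodynamic limit" (12 book hits:
LSSY2005, Griffin–Snoke–Stringari 1995, Pethick–Smith; nothing multiscale); `lit search --source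
crossref` "BEC multiscale block coherence
density matrix triangle inequality" (10 textbook chapters) and "block spin long range order N-vector
Balaban O'Carroll" (doi:10.1007/s002200050510,
10.1007/bf02099355, 10.1007/bf02506422, 10.1007/s002200050433); `--source arxiv|s2|openalex` HTTP
429, zbmath 0; `lit galaxy search --star all`
×3 ("condensation on length scales" 0 rows; "condensate fraction" 8 pdf rows, none structural; one
saturated); `lit frontier AtomisticToContinuum
--since 2020` (BEC descendants arXiv:2603.20776, arXiv:2510.20493, arXiv:2602.16566); `lit read
arXiv:2603.20776` pp. 4, 6 (Thm 3, Cor 6, Rem 5, 7);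
in-ledger: 16 BEC route files read (none decomposes by scale in the fixed box), card audit-15
prior-art list reused.
Nearest prior art found: Junge2026 = arXiv:2603.20776 Thm 3/Cor 6 (ONE Neumann coarse-graining step,
pays R²); Fournais2020 Thm 1.2 and LSSY2005
Thm 5.1 (kinetic-gap condensation on density-tied scales); BalabanOcarroll1999 / Balaban1995
(block-spin LRO for classical N-vector models with
summable per-scale budgets); BFKT2017 (block-averaged Bose fields, small-field parabolic flow; route
BECRenormGroup); card hierarchical-bose-gas-ladder
(same dyadic block-condensate modes but for Dyson's hierarchical Laplacian).
Del  [refs: 10.1007/s002200050510, 10.1007/bf02099355, 10.1007/bf02506422, 10.1007/s002200050433, 2603.20776, 2510.20493, 2602.16566, doi:10.1007/s002200050510, LSSY2005, Junge2026, Fournais2020, BalabanOcarroll1999, Balaban1995, BFKT2017]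

Barriers (technique_class: multiscale-coherence, gram-norm-defect, josephson-blocks): - technique_class: multiscale-coherence, gram-norm-defect, josephson-blocks
- Literature.Barriers.AtomisticToContinuum.KineticGapLengthScales: USED, not fought, where it is a
theorem: BaseCoherentMass sits at ℓ_b ~ ξ√ε (LSSY Thm 5.1's home scale) and WindowLocalCondensation
at Fournais/Junge scales; above the window DyadicCoherenceDefect asks per level only for a defect of
relative size √(E_C/E_J) ∝ ℓ⁻², comparing sibling cubes at the SAME scale rather than a cube with
its excitations, so no ℓ² gap factor is built into the statement — whether an engine avoids paying
it is exactly rank 2 (conceded: every engine in print pays it, Junge2026 Rem 7).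
- Literature.Barriers.AtomisticToContinuum.KineticGapLengthScalesNarrow: the Galilei-boost no-go (δ
> 4π²M²N/L² certifies c ≤ 1/(M+1)) does not bite — every item quantifies ∃δ after N (sub-gap window,
near-minimisers = ground state up to o(1)); it does certify that rank 2 can never follow from an
energy bound with δ ≳ N/L², so the per-level engine must use ground-state structure (stationarity
inequalities), by design.
- Literature.Barriers.AtomisticToContinuum.EnergyAsymptoticsWithoutCondensation: the per-level
demand at scale ℓ ≫ ξ is worth (ξ/ℓ)⁴ × LHY in energy — below any energy expansion — so energy-only
engines are excluded above the window (conceded); energies enter only at the base and in the window,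
through the catalogued evasion (local condensation on density-tied boxes).
- Literature.Barriers.AtomisticToContinuum.Bogoliubov

History (route lifecycle, newest last):
- 2026-08-15T13:40:21Z · CLOSED retired — not-a-thesis: assembly does not conclude the sub-problem Statement (operator:999:1257524)

sub-problem: BoseEinsteinCondensation · status: closed(retired) · opened planner-plancard-AtomisticToContinuum-BoseEin-01530ea2-0 2026-08-15T11:42:06Z · rev 0 · ledger route-AtomisticToContinuum-BECScaleChaining
GENERATED by the gate from the ledger (D-0016/17). Provers cite these decls: `theorem foo : Summit.AtomisticToContinuum.BoseEinsteinCondensation.Theses.BECScaleChaining.<Decl> := …` in Summits/AtomisticToContinuum/BoseEinsteinCondensation/Theorems/<Name>.lean.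
-/

namespace Summit.AtomisticToContinuum.BoseEinsteinCondensation.Theses.BECScaleChaining

open scoped BigOperators Topology Manifold Classical MeasureTheory ProbabilityTheory Matrix InnerProductSpace ComplexConjugate ContinuousMap
open Filter Set Function TopologicalSpace MeasureTheory

attribute [summit_statement] _root_.BoseEinsteinCondensation

/-- item stmt-AtomisticToContinuum-5683 · crux · rank 2 · closed · moot by None · by planner
why it might fail: at the top levels (cube side L/2, L/4) β_j → 0 demands inter-octant phase coherence of the Dirichlet ground state uniformly in N — the thermodynamic difficulty itself; an energetic per-level engine pays ℓ²×(local excess) as in Junge2026 Rem 7, and no non-energetic engine is in print.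
sources: arXiv:2603.20776, Fournais2020, Leggett2001, LSSY2005, BFKT2017
[crux] SUMMABLE DYADIC COHERENCE DEFECT (card K1, quadrature form). For every repulsive finite-range
v there are ℓ_d(v) > 0 and ρ₀ > 0 such that for 0 < ρ < ρ₀ there is a budget β : ℕ → [0,∞), Σ_j β_j
≤ 1/4, with: for all large N there is δ > 0 such that every δ-near-minimiser Ψ of the Dirichlet
energy in the box of side L = (N/ρ)^{1/3} satisfies, for every level m ≥ 1 whose cube side L/2^m
lies in [ℓ_d 2^j, ℓ_d 2^{j+1}): A_m ≤ A_{m−1} + β_j √N, where A_m = 8^{-m/2} Σ_{C level m}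
√(occupation of s^{-3/2}1_C). Equivalently: the norm defect Σ_P(Σ_C‖u_C‖ − ‖Σ_C u_C‖) summed over
parents of side 2^{1+j}ℓ_d is ≤ 8^{m/2} β_j √N, uniformly in N. [difficulty: open-problem] -/
@[route_item "route-AtomisticToContinuum-BECScaleChaining"]
def DyadicCoherenceDefect : Prop :=
  ∀ v : ℝ → ENNReal, Literature.MathematicalPhysics.QuantumManyBody.BoseGas.IsRepulsiveFiniteRange v → ∃ ℓd : ℝ, 0 < ℓd ∧ ∃ ρ₀ : ℝ, 0 < ρ₀ ∧ ∀ ρ : ℝ, 0 < ρ → ρ < ρ₀ → ∃ β : ℕ → ℝ, (∀ j, 0 ≤ β j) ∧ Summable β ∧ ∑' j, β j ≤ 1 / 4 ∧ ∀ᶠ N : ℕ in Filter.atTop, let L : ℝ := Literature.MathematicalPhysics.QuantumManyBody.BoseGas.sideLength ρ N; let φ : (m : ℕ) → (Fin 3 → Fin (2 ^ m)) → EuclideanSpace ℝ (Fin 3) → ℂ := fun m i => Set.indicator {x : EuclideanSpace ℝ (Fin 3) | ∀ k : Fin 3, x k ∈ Set.Ioo (((i k : ℕ) : ℝ) * (L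 / 2 ^ m)) ((((i k : ℕ) : ℝ) + 1) * (L / 2 ^ m))} (fun _ => ((Real.sqrt ((L / 2 ^ m) ^ 3))⁻¹ : ℂ)); ∃ δ : ENNReal, 0 < δ ∧ ∀ Ψ : Literature.MathematicalPhysics.QuantumManyBody.BoseGas.TrialState N L, Literature.MathematicalPhysics.QuantumManyBody.BoseGas.energy v Ψ ≤ Literature.MathematicalPhysics.QuantumManyBody.BoseGas.groundStateEnergy v N L + δ → let A : ℕ → ENNReal := fun m => (8 : ENNReal) ^ (-(m : ℝ) / 2) * ∑ i : Fin 3 → Fin (2 ^ m), (Literature.MathematicalPhysics.QuantumManyBody.BoseGas.occupation N (φ m i) Ψ.ψ) ^ (1 / 2 : ℝ); ∀ m j : ℕ, 1 ≤ m → ℓd * 2 ^ j ≤ L / 2 ^ m → L / 2 ^ m < ℓd * 2 ^ (j + 1) → A m ≤ A (m - 1) + ENNReal.ofReal (β j) * (N : ENNReal) ^ (1 / 2 : ℝ)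

/-- item stmt-AtomisticToContinuum-5684 · crux · rank 3 · closed · moot by None · by planner
why it might fail: needs E₀ < ∞ and E₀ ≤ 4πaρN(1+o(1)) + O(N/L²) for DIRICHLET boxes incl. hard cores (only periodic upper bound in tree), and no-clumping Σ_B N_B² ≲ N²/8^K from cell-wise LY bounds, which require cells ≥ a(ρa³)^{-6/17} and n_B ≳ (ℓ_b/a)^{1/6}.
sources: LSSY2005, LiebYngvason1998, Fournais2020, arXiv:2510.20493
[crux] COHERENT MASS AT A HEALING-TYPE BASE SCALE (card P/WindowBase moved down to ℓ_b ~ ξ√ε). For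
every repulsive finite-range v and every ℓ_d > 0 there is ρ₀ > 0 such that for 0 < ρ < ρ₀ there is
ℓ_b ≥ ℓ_d with: for all large N there are a level K with L/2^K ∈ [ℓ_b, 2ℓ_b) and δ > 0 such that
every δ-near-minimiser has A_K ≥ √N/2, i.e. (8^{-K/2} Σ_B √n_B)² ≥ N/4 over the base cubes B. Route
to it: Σ_B n_B ≥ (1−ε)N by Poincaré in each cube against T ≤ C N ρ a (+ walls), and (Σ√n_B)² ≥ (Σ
n_B)³/Σ n_B² with anti-concentration Σ_B N_B² ≤ Λ N² 8^{-K} from the Lieb–Yngvason cell lower bound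
versus the leading upper bound; free gas: A_K/√N → (2√2/π)³ ≈ 0.73. [difficulty: L] -/
@[route_item "route-AtomisticToContinuum-BECScaleChaining"]
def BaseCoherentMass : Prop :=
  ∀ v : ℝ → ENNReal, Literature.MathematicalPhysics.QuantumManyBody.BoseGas.IsRepulsiveFiniteRange v → ∀ ℓd : ℝ, 0 < ℓd → ∃ ρ₀ : ℝ, 0 < ρ₀ ∧ ∀ ρ : ℝ, 0 < ρ → ρ < ρ₀ → ∃ ℓb : ℝ, ℓd ≤ ℓb ∧ ∀ᶠ N : ℕ in Filter.atTop, let L : ℝ := Literature.MathematicalPhysics.QuantumManyBody.BoseGas.sideLength ρ N; let φ : (m : ℕ) → (Fin 3 → Fin (2 ^ m)) → EuclideanSpace ℝ (Fin 3) → ℂ := fun m i => Set.indicator {x : EuclideanSpace ℝ (Fin 3) | ∀ k : Fin 3, x k ∈ Set.Ioo (((i k : ℕ) : ℝ) * (L / 2 ^ m)) ((((i k : ℕ) : ℝ) + 1) * (L / 2 ^ m))} (fun _ => ((Real.sqrt ((L / 2 ^ m) ^ 3))⁻¹ : ℂ)); ∃ K : ℕ, ℓb ≤ L / 2 ^ K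 ∧ L / 2 ^ K < 2 * ℓb ∧ ∃ δ : ENNReal, 0 < δ ∧ ∀ Ψ : Literature.MathematicalPhysics.QuantumManyBody.BoseGas.TrialState N L, Literature.MathematicalPhysics.QuantumManyBody.BoseGas.energy v Ψ ≤ Literature.MathematicalPhysics.QuantumManyBody.BoseGas.groundStateEnergy v N L + δ → (N : ENNReal) ^ (1 / 2 : ℝ) ≤ 2 * ((8 : ENNReal) ^ (-(K : ℝ) / 2) * ∑ i : Fin 3 → Fin (2 ^ K), (Literature.MathematicalPhysics.QuantumManyBody.BoseGas.occupation N (φ K i) Ψ.ψ) ^ (1 / 2 : ℝ))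

/-- item stmt-AtomisticToContinuum-5685 · crux · rank 4 · closed · moot by None · by planner
why it might fail: Fournais2020 Thm 1.2 is for PERIODIC states with the LHY-precision bound (1.8) on a torus tied to its own density; localising the Dirichlet ground state into dyadic sub-cubes of varying local density with constants uniform in (C_L, δ) and summing over cubes is not in print.
sources: Fournais2020, FournaisSolovej2020, BrietzkeFournaisSolovej2020, arXiv:2603.20776, arXiv:2510.20493
[crux] LOCAL CONDENSATION OF THE THERMODYNAMIC GROUND STATE ON ALL DYADIC SCALES UP TO THE FOURNAIS
WINDOW (card engine (iii); the provable half of rank 2, not in the assembly chain). For every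
repulsive finite-range v (a = scattering length) and every η ∈ (0, 1/4) there are γ > 2η, C ≥ 0 and
ρ₀ > 0 such that for 0 < ρ < ρ₀, all large N, some δ > 0 and every δ-near-minimiser Ψ of the
Dirichlet box of side L = (N/ρ)^{1/3}: for every level m with cube side s = L/2^m ≤
(ρa)^{-1/2}(ρa³)^{-η}, Σ_{C level m} ⟨φ_C, γ_Ψ φ_C⟩ ≥ (1 − C(ρa³)^γ max(1, ρ a s²)) N. Via Σ_C‖u_C‖
− ‖Σu_C‖ ≤ √(8(N_P − n_P)) it yields the window part of DyadicCoherenceDefect with Σ_{window} β ≲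
(ρa³)^{γ/2−η} + (ρa³)^{γ/2} log(1/ρ). Vacuous (true) for a = 0. [difficulty: XL] -/
@[route_item "route-AtomisticToContinuum-BECScaleChaining"]
def WindowLocalCondensation : Prop :=
  ∀ v : ℝ → ENNReal, Literature.MathematicalPhysics.QuantumManyBody.BoseGas.IsRepulsiveFiniteRange v → ∀ η : ℝ, 0 < η → η < 1 / 4 → ∃ γ C : ℝ, 2 * η < γ ∧ 0 ≤ C ∧ ∃ ρ₀ : ℝ, 0 < ρ₀ ∧ ∀ ρ : ℝ, 0 < ρ → ρ < ρ₀ → ∀ᶠ N : ℕ in Filter.atTop, let a : ℝ := (Literature.MathematicalPhysics.QuantumManyBody.BoseGas.scatteringLength v).toReal; let L : ℝ := Literature.MathematicalPhysics.QuantumManyBody.BoseGas.sideLength ρ N; let φ : (m : ℕ) → (Fin 3 → Fin (2 ^ m)) → EuclideanSpace ℝ (Fin 3) → ℂ := fun m i => Set.indicator {x : EuclideanSpace ℝ (Fin 3) | ∀ k : Fin 3, x k ∈ Set.Ioo (((i k : ℕ) : ℝ) * (L / 2 ^ m)) ((((i k : ℕ) : ℝ) + 1) * (L / 2 ^ m))}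 (fun _ => ((Real.sqrt ((L / 2 ^ m) ^ 3))⁻¹ : ℂ)); ∃ δ : ENNReal, 0 < δ ∧ ∀ Ψ : Literature.MathematicalPhysics.QuantumManyBody.BoseGas.TrialState N L, Literature.MathematicalPhysics.QuantumManyBody.BoseGas.energy v Ψ ≤ Literature.MathematicalPhysics.QuantumManyBody.BoseGas.groundStateEnergy v N L + δ → ∀ m : ℕ, L / 2 ^ m ≤ (ρ * a) ^ (-(1 : ℝ) / 2) * (ρ * a ^ 3) ^ (-η) → ENNReal.ofReal ((1 - C * (ρ * a ^ 3) ^ γ * max 1 (ρ * a * (L / 2 ^ m) ^ 2)) * N) ≤ ∑ i : Fin 3 → Fin (2 ^ m), Literature.MathematicalPhysics.QuantumManyBody.BoseGas.occupation N (φ m i) Ψ.ψ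

/-- item stmt-AtomisticToContinuum-5686 · support · rank 9 · closed · moot by None · by planner
sources: LSSY2005, PenroseOnsager1956
[support] For every N, L, every Dirichlet trial state Ψ and every level m ≥ 1: A_{m−1} ≤ A_m (sum of
norms ≥ norm of sum for the eight child Gram vectors of each parent cube; needs the L²(Y)-structure
of `occupation`: u_φ ∈ L², φ ↦ u_φ linear, occupation = ‖u_φ‖², and φ_P = 8^{-1/2} Σ φ_C a.e.).
Establishes the Hilbert-space API every other item uses. [difficulty: provable-now] -/
@[route_item "route-AtomisticToContinuum-BECScaleChaining"]
def CoherentAmplitudeMonotone : Prop :=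
  ∀ (N : ℕ) (L : ℝ) (Ψ : Literature.MathematicalPhysics.QuantumManyBody.BoseGas.TrialState N L) (m : ℕ), 1 ≤ m → let φ : (m : ℕ) → (Fin 3 → Fin (2 ^ m)) → EuclideanSpace ℝ (Fin 3) → ℂ := fun m i => Set.indicator {x : EuclideanSpace ℝ (Fin 3) | ∀ k : Fin 3, x k ∈ Set.Ioo (((i k : ℕ) : ℝ) * (L / 2 ^ m)) ((((i k : ℕ) : ℝ) + 1) * (L / 2 ^ m))} (fun _ => ((Real.sqrt ((L / 2 ^ m) ^ 3))⁻¹ : ℂ)); let A : ℕ → ENNReal := fun m => (8 : ENNReal) ^ (-(m : ℝ) / 2) * ∑ i : Fin 3 → Fin (2 ^ m), (Literature.MathematicalPhysics.QuantumManyBody.BoseGas.occupation N (φ m i) Ψ.ψ) ^ (1 / 2 : ℝ); A (m - 1) ≤ A m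

/-- item stmt-AtomisticToContinuum-5687 · assembly · rank 1 · closed · moot by None · by planner
sources: LSSY2005, PenroseOnsager1956
[assembly] DyadicCoherenceDefect → BaseCoherentMass → BoseEinsteinCondensation (telescoping in ℝ≥0∞
with √N finite; level-0 mode = constant mode; bec_of_zeroMode). -/
@[route_item "route-AtomisticToContinuum-BECScaleChaining"]
def Assembly : Prop :=
  DyadicCoherenceDefect → BaseCoherentMass → Literature.MathematicalPhysics.QuantumManyBody.BoseGas.BoseEinsteinCondensation

end Summit.AtomisticToContinuum.BoseEinsteinCondensation.Theses.BECScaleChaining
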